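import Summits.BirchSwinnertonDyer.BirchSwinnertonDyer.Theorems.GenusKolyvaginAtTwoFullVertexDefs
import HarnessLib

/-!
# SEL by-product: `ker Φ₃(A)` is an `𝔽₄`-space — its `𝔽₂`-dimension is EVEN (parity is built into the iso-class Selmer laws)

Crux R″ `RankOneTwoTorsionResidualAtTwo` (stmt-27478), LINE 49 «torsion_cell_full_vertex_bsdidea1», §2 SEL («PARITY built in»).  For any
square matrix `A` over `𝔽₂`, the kernel `K = ker Φ₃(A)`, `Φ₃(t) = t² + t + 1`, is stable under `A`, on which `A³ = 1` and `A` has no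
non-zero fixed vector; so the cyclic group `⟨A⟩` of order `3` acts on `K` with the single fixed point `0`, whence `#K ≡ 1 (mod 3)`
(`IsPGroup.card_modEq_card_fixedPoints`) and, as `#K = 2^{dim K}`, **`dim_𝔽₂ K` is even** (`even_finrank_ker_phi3`), i.e.
**`#K = 4^j`** (`natCard_ker_phi3_eq_four_pow`).  Consequence for LINE 49's SEL laws (`#Sel₂(C₀) = 4·#ker Φ₃(Ĝ)`,
`#Sel₂(C₁) = 8·#ker Φ₃(B)`): `dim Sel₂(C₀)` is EVEN and `dim Sel₂(C₁)` is ODD — the Selmer parities predicted for the rank-`0` /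
rank-`1` members of the genus pair, obtained here with no root-number input.

Everything is proved; no LINE 49 statement is restated; BSD is not advanced by this file alone.

## References

* [HeathBrown1994SelmerCongruentII] D. R. Heath-Brown, Invent. Math. 118 (1994), §2 (the `𝔽₄`-structure on the Selmer kernel).
* [Kane2013SelmerTwists] D. M. Kane, Algebra Number Theory 7 (2013), §2.
-/

namespace Summit.BirchSwinnertonDyer.BirchSwinnertonDyer.Theorems.GenusKolyvaginAtTwo.FullVertex

open Matrix MulAction

variable {n : Type*} [Fintype n] [DecidableEq n]

/-- `Φ₃(A)x = A(Ax) + Ax + x`. [cite: HeathBrown1994SelmerCongruentII, §2] -/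
theorem phi3_mulVec_eq (A : Matrix n n (ZMod 2)) (x : n → ZMod 2) :
    phi3 A *ᵥ x = A *ᵥ (A *ᵥ x) + A *ᵥ x + x := by
  unfold phi3
  rw [add_mulVec, add_mulVec, one_mulVec, ← mulVec_mulVec]

/-- `ker Φ₃(A)` is `A`-stable. [cite: HeathBrown1994SelmerCongruentII, §2] -/
theorem mulVec_mem_ker_phi3 {A : Matrix n n (ZMod 2)} {x : n → ZMod 2} (hx : x ∈ LinearMap.ker (phi3 A).mulVecLin) :
    A *ᵥ x ∈ LinearMap.ker (phi3 A).mulVecLin := by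
  rw [LinearMap.mem_ker, Matrix.mulVecLin_apply] at hx ⊢
  rw [phi3_mulVec_eq, ← mulVec_add, ← mulVec_add, ← phi3_mulVec_eq, hx, mulVec_zero]

/-- `𝔽₂` pointwise: `a + b + a = b`. [folklore] -/
private theorem zmod2_aba (a b : ZMod 2) : a + b + a = b := by revert a b; decide

/-- `𝔽₂` pointwise: `a + a + a = 0 → a = 0`. [folklore] -/
private theorem zmod2_aaa (a : ZMod 2) (h : a + a + a = 0) : a = 0 := by revert a h; decide

/-- On `ker Φ₃(A)`: `A² = A + 1`. [cite: HeathBrown1994SelmerCongruentII, §2] -/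
theorem mulVec_mulVec_eq_of_mem_ker {A : Matrix n n (ZMod 2)} {x : n → ZMod 2} (hx : x ∈ LinearMap.ker (phi3 A).mulVecLin) :
    A *ᵥ (A *ᵥ x) = A *ᵥ x + x := by
  rw [LinearMap.mem_ker, Matrix.mulVecLin_apply, phi3_mulVec_eq] at hx
  ext i
  have h := congrFun hx i
  simp only [Pi.add_apply, Pi.zero_apply] at h ⊢
  have key : ∀ a b c : ZMod 2, a + b + c = 0 → a = b + c := by decide
  exact key _ _ _ h

/-- On `ker Φ₃(A)`: `A³ = 1`. [cite: HeathBrown1994SelmerCongruentII, §2] -/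
theorem mulVec_pow_three_eq_of_mem_ker {A : Matrix n n (ZMod 2)} {x : n → ZMod 2} (hx : x ∈ LinearMap.ker (phi3 A).mulVecLin) :
    A *ᵥ (A *ᵥ (A *ᵥ x)) = x := by
  rw [mulVec_mulVec_eq_of_mem_ker (mulVec_mem_ker_phi3 hx), mulVec_mulVec_eq_of_mem_ker hx]
  ext i
  simp only [Pi.add_apply]
  exact zmod2_aba _ _

/-- On `ker Φ₃(A)`: `A` has no non-zero fixed vector. [cite: HeathBrown1994SelmerCongruentII, §2] -/
theorem eq_zero_of_mulVec_eq_self_of_mem_ker {A : Matrix n n (ZMod 2)} {x : n → ZMod 2}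
    (hx : x ∈ LinearMap.ker (phi3 A).mulVecLin) (hfix : A *ᵥ x = x) : x = 0 := by
  rw [LinearMap.mem_ker, Matrix.mulVecLin_apply, phi3_mulVec_eq, hfix, hfix] at hx
  ext i
  exact zmod2_aaa _ (by simpa only [Pi.add_apply, Pi.zero_apply] using congrFun hx i)

/-- `2^d ≡ 2 (mod 3)` for odd `d`. [folklore] -/
private theorem two_pow_mod_three_of_odd {d : ℕ} (hd : Odd d) : 2 ^ d % 3 = 2 := by
  obtain ⟨j, rfl⟩ := hd
  have h4 : 4 ^ j % 3 = 1 := by rw [Nat.pow_mod]; simp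
  rw [show 2 ^ (2 * j + 1) = 4 ^ j * 2 by rw [pow_succ, pow_mul]; norm_num, Nat.mul_mod, h4]

/-- **`dim_𝔽₂ ker Φ₃(A)` IS EVEN** (see the module docstring). [cite: HeathBrown1994SelmerCongruentII, §2]
[cite: Kane2013SelmerTwists, §2] -/
theorem even_finrank_ker_phi3 (A : Matrix n n (ZMod 2)) :
    Even (Module.finrank (ZMod 2) (LinearMap.ker (phi3 A).mulVecLin)) := by
  classical
  set K := LinearMap.ker (phi3 A).mulVecLin with hK
  -- the order-3 permutation `x ↦ Ax` of `K`
  let σ : Equiv.Perm K :=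
    { toFun := fun x => ⟨A *ᵥ (x : n → ZMod 2), mulVec_mem_ker_phi3 x.2⟩
      invFun := fun x => ⟨A *ᵥ (A *ᵥ (x : n → ZMod 2)), mulVec_mem_ker_phi3 (mulVec_mem_ker_phi3 x.2)⟩
      left_inv := fun x => Subtype.ext (mulVec_pow_three_eq_of_mem_ker x.2)
      right_inv := fun x => Subtype.ext (mulVec_pow_three_eq_of_mem_ker x.2) }
  have hσ : ∀ x : K, ((σ x : K) : n → ZMod 2) = A *ᵥ (x : n → ZMod 2) := fun _ => rfl
  have hσ3 : σ ^ 3 = 1 := by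
    ext x
    -- `σ³ x = A(A(Ax)) = x`
    change ((σ (σ (σ x)) : K) : n → ZMod 2) _ = _
    rw [hσ, hσ, hσ, mulVec_pow_three_eq_of_mem_ker x.2]
    rfl
  -- the cyclic group it generates is a `3`-group acting on `K` with the single fixed point `0`
  set G : Subgroup (Equiv.Perm K) := Subgroup.zpowers σ with hG
  have hPG : IsPGroup 3 G := by
    intro g
    refine ⟨1, ?_⟩
    obtain ⟨k, hk⟩ := Subgroup.mem_zpowers_iff.mp g.2
    ext1
    rw [pow_one, SubgroupClass.coe_pow, ← hk, ← zpow_natCast, ← zpow_mul, mul_comm, zpow_mul, zpow_natCast, hσ3, one_zpow,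
      Subgroup.coe_one]
  haveI : Finite K := inferInstance
  have hmod := hPG.card_modEq_card_fixedPoints K
  have hfix : fixedPoints G K = {0} := by
    ext x
    rw [mem_fixedPoints, Set.mem_singleton_iff]
    constructor
    · intro h
      have h1 := h ⟨σ, Subgroup.mem_zpowers σ⟩
      rw [Subgroup.mk_smul, Equiv.Perm.smul_def] at h1
      have h2 : A *ᵥ (x : n → ZMod 2) = x := by rw [← hσ, h1]
      exact Subtype.ext (eq_zero_of_mulVec_eq_self_of_mem_ker x.2 h2)
    · rintro rfl g
      obtain ⟨k, hk⟩ := Subgroup.mem_zpowers_iff.mp g.2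
      rw [Subgroup.smul_def, Equiv.Perm.smul_def, ← hk]
      -- every power of `σ` fixes `0`
      have h0 : σ 0 = 0 := Subtype.ext (by rw [hσ]; simp)
      have hz : ∀ m : ℤ, (σ ^ m) 0 = 0 := by
        intro m
        induction m using Int.induction_on with
        | zero => simp
        | succ i ih => rw [zpow_add_one, Equiv.Perm.mul_apply, h0, ih]
        | pred i ih =>
          rw [zpow_sub_one, Equiv.Perm.mul_apply]
          have : σ⁻¹ 0 = 0 := by rw [Equiv.Perm.inv_eq_iff_eq]; exact h0.symm
          rw [this, ih]
      exact hz k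
  have h1 : Nat.card (({0} : Set K) : Set K) = 1 := by rw [Nat.card_eq_fintype_card, Set.card_singleton]
  rw [hfix, h1] at hmod
  -- `#K = 2^{dim K} ≡ 1 (mod 3)` forces `dim K` even
  have hcard : Nat.card K = 2 ^ Module.finrank (ZMod 2) K := by
    rw [Module.natCard_eq_pow_finrank (K := ZMod 2), Nat.card_zmod]
  rw [hcard, Nat.ModEq] at hmod
  by_contra hodd
  rw [two_pow_mod_three_of_odd (Nat.not_even_iff_odd.mp hodd)] at hmod
  norm_num at hmod

/-- **`#ker Φ₃(A) = 4^{dim/2}`** — the cardinality form used by the SEL laws. [cite: HeathBrown1994SelmerCongruentII, §2] -/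
theorem natCard_ker_phi3_eq_four_pow (A : Matrix n n (ZMod 2)) :
    Nat.card (LinearMap.ker (phi3 A).mulVecLin) = 4 ^ (Module.finrank (ZMod 2) (LinearMap.ker (phi3 A).mulVecLin) / 2) := by
  obtain ⟨j, hj⟩ := even_finrank_ker_phi3 A
  rw [Module.natCard_eq_pow_finrank (K := ZMod 2), Nat.card_zmod, hj, ← two_mul, Nat.mul_div_cancel_left j two_pos, pow_mul]
  norm_num

end Summit.BirchSwinnertonDyer.BirchSwinnertonDyer.Theorems.GenusKolyvaginAtTwo.FullVertex
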